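import Summits.QuantumFields.YangMills.Theorems.VirialFluxGapFixCoord
import HarnessLib

/-!
# ★★★ The chart identity `hloc` on `X_fix` in the LITERAL format of ✓`laplaceMethod_quantitative_orbit_tube`
# (layer (B2) of the DIRECT Laplace road to ⟨stmt-QuantumFields-24204⟩ `VirialFluxGap.SharpTwistedLaplace` — keystone identity COMPLETE)

Helper module (free-hands work of width seat ym-line-sfw-p2-w3 g57, cell ym-idea-1; `--supports 24204`).  Sequel of ✓`VirialFluxGapFixSliceChartLocal`
(chart identity on the injectivity window, coordinates `ℝ³ × (ℝ³ × RestParam)`, measure `Leb³ ⊗ (Leb³ ⊗ restParamMeasure)`) and ✓`VirialFluxGapFixCoord`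
(the Euclidean model `V = EuclideanSpace ℝ (Fin fixDim)`, `fixCoord_* vol_V = Leb³ ⊗ restLebesgue`):
* §1 `restParamMeasure_eq_withDensity` — `restParamMeasure = (∏_c 𝟙_{ball π} expWeight) · restLebesgue` (§1 of `…FixCoord`: `pi_withDensity`);
* §2 `continuous_fixSplit_symm`, `continuous_restChart_param`, ★ `continuous_fixWindowMap`, `measurable_fixWindowMap`;
* §3 ★★ `restrict_image_fixCoord_window` — the LINEAR chart `id × fixCoord` with weight: on `Φ × B̄_V(R)` (`R < π`)
  `(Leb³⊗(Leb³⊗restParamMeasure))|_{(id×fixCoord)(Φ×B̄)} = (id×fixCoord)_*((restWeight∘rest∘fixCoord) · (Leb³⊗vol_V)|_{Φ×B̄})`;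
* §4 ★★★ `fix_hloc` — for anchors `(ωC, ωN, ωX, C₀, ±N₀)`, any rest base point `R`, a measurable `Φ ⊆ closedBall 0 r` (`r < π/2`) and `R_V < 1`:
  `μ_fix|_{Θ'(Φ × B̄_{R_V})} = Θ'_*( ofReal(restWeight · anchorDensity) · (Leb³ ⊗ vol_V)|_{Φ × B̄_{R_V}} )` with
  `Θ'(z, y) = fixWindowMap(z, fixCoord y)` — EXACTLY hypothesis `hloc` of the orbit theorem with `Z = ℝ³`, `κ = volume`, `V = ℝ^{fixDim}`,
  `J(z, y) = restWeight(rest(fixCoord y)) · anchorDensity(z, a(fixCoord y))` (composition ✓`chart_comp_of_injOn_ofReal` of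
  ✓`fix_restrict_image_windowMap_domain` with §3; image measurability by Lusin–Souslin through `continuous_fixWindowMap` + ✓`injOn_fixWindowMap`).
What is still to do for the orbit theorem on `X_fix` (memo `w3-g57-ANCHOR-CHART-24204.md` §3): the `j`-window datum `hw` (✓`exists_anchor_window_datum`
× ✓`VirialFluxGapProductSincWeight`), the slice hypotheses `hslice ∕ hfix` (✓`su2_eq_one_or_negOne_of_conj_anchor_pair`), `hT ∕ hA ∕ hc0 ∕ hctop`,
and the ANALYTIC data (`hf` from ✓`RingChartPhase` along `fixSlice`, coercivity `λ ≥ 1/poly(L)`, `hfloor`).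
Everything here is PROVED; no definitions, no named facts.  HONEST FRAMING: measure-theoretic plumbing; ⟨24204⟩, ⟨24319⟩ and every rung stay OPEN;
the Yang–Mills mass gap (Clay) is NOT touched; no summit is proved by a line.

## References
* S. Helgason, *Groups and Geometric Analysis* (2000), Ch. I §1 Thm 1.14. [Helgason2000]
* K. W. Breitung, *Asymptotic Approximations for Probability Integrals*, LNM 1592 (1994), §2.3 Definitions 4–5; Thm 41. [Breitung1994]
* G. E. Bredon, *Introduction to Compact Transformation Groups* (1972), Ch. II §§4–5. [Bredon1972]
-/

set_option autoImplicit false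

noncomputable section

open MeasureTheory Set Filter Metric WithLp
open scoped ENNReal RealInnerProductSpace
open Literature.MathematicalPhysics.QuantumLattice
open Literature.MathematicalPhysics.QuantumFieldTheory hiding SU2
open Literature.MathematicalPhysics.QuantumFieldTheory.Balaban1983to89.T4HaarSU2ExpChart
open Literature.MathematicalPhysics.QuantumFieldTheory.Balaban1983to89.T4ExpWindowSmallField
open Summit.QuantumFields.YangMills.Theorems.FemtoTransferGap
open Summit.QuantumFields.YangMills.Theorems.FemtoTransferGap.TT
open Summit.QuantumFields.YangMills.Theorems.VirialFluxGap.AnchorSlice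
open Summit.QuantumFields.YangMills.Theorems.VirialFluxGap.ConjChart
open Summit.QuantumFields.YangMills.Theorems.VirialFluxGap.ChartTensor

namespace Summit.QuantumFields.YangMills.Theorems.VirialFluxGap.FixSplit

variable {L : ℕ} [NeZero L] {e₀ : OffIdx L} {y₀ : Site 3 L}

/-! ## §1 The law of the rest coordinates is weighted Lebesgue measure -/

/-- The exponential-chart law is Lebesgue measure with density `𝟙_{ball π} · expWeight`. [cite: Helgason2000, Ch. I §1 Thm 1.14] -/
theorem expMeasure_eq_withDensity_indicator :
    expMeasure = (volume : Measure (EuclideanSpace ℝ (Fin 3))).withDensity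
      ((ball (0 : EuclideanSpace ℝ (Fin 3)) Real.pi).indicator fun x => ENNReal.ofReal (expWeight x)) := by
  rw [withDensity_indicator measurableSet_ball]; rfl

/-- ★ **`restParamMeasure = (∏_c 𝟙_{ball π}(b_c) expWeight(b_c)) · restLebesgue`.** [cite: Helgason2000, Ch. I §1 Thm 1.14] -/
theorem restParamMeasure_eq_withDensity :
    restParamMeasure L e₀ y₀ = (restLebesgue L e₀ y₀).withDensity fun b =>
      (∏ i, (ball (0 : EuclideanSpace ℝ (Fin 3)) Real.pi).indicator (fun x => ENNReal.ofReal (expWeight x)) (b.1 i)) *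
        ((∏ j, ∏ e, (ball (0 : EuclideanSpace ℝ (Fin 3)) Real.pi).indicator (fun x => ENNReal.ofReal (expWeight x)) (b.2.1 j e)) *
          ∏ s, (ball (0 : EuclideanSpace ℝ (Fin 3)) Real.pi).indicator (fun x => ENNReal.ofReal (expWeight x)) (b.2.2 s)) := by
  set g : EuclideanSpace ℝ (Fin 3) → ℝ≥0∞ :=
    (ball (0 : EuclideanSpace ℝ (Fin 3)) Real.pi).indicator fun x => ENNReal.ofReal (expWeight x) with hg
  have hgm : Measurable g := measurable_expWeight.ennreal_ofReal.indicator measurableSet_ball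
  have hexp : expMeasure = (volume : Measure (EuclideanSpace ℝ (Fin 3))).withDensity g := expMeasure_eq_withDensity_indicator
  haveI : SigmaFinite ((volume : Measure (EuclideanSpace ℝ (Fin 3))).withDensity g) := by rw [← hexp]; infer_instance
  have hpi : ∀ (ι : Type) [Fintype ι], Measure.pi (fun _ : ι => expMeasure) =
      (Measure.pi fun _ : ι => (volume : Measure (EuclideanSpace ℝ (Fin 3)))).withDensity fun b => ∏ i, g (b i) := by
    intro ι _
    rw [hexp]
    exact pi_withDensity _ _ fun _ => hgm
  have hpm : ∀ (ι : Type) [Fintype ι], Measurable fun b : ι → EuclideanSpace ℝ (Fin 3) => ∏ i, g (b i) := fun ι _ =>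
    Finset.measurable_prod _ fun i _ => hgm.comp (measurable_pi_apply i)
  have hE := hpi (Edge 3 L)
  haveI : SigmaFinite ((Measure.pi fun _ : Edge 3 L => (volume : Measure (EuclideanSpace ℝ (Fin 3)))).withDensity
      fun b => ∏ e, g (b e)) := by rw [← hE]; infer_instance
  have h2 : Measure.pi (fun _ : Fin (2 * L - 1) => Measure.pi fun _ : Edge 3 L => expMeasure) =
      (Measure.pi fun _ : Fin (2 * L - 1) => Measure.pi fun _ : Edge 3 L => (volume : Measure (EuclideanSpace ℝ (Fin 3)))).withDensity
        fun f => ∏ j, ∏ e, g (f j e) := by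
    rw [hE]
    exact pi_withDensity _ _ fun _ => hpm (Edge 3 L)
  have h2m : Measurable fun f : Fin (2 * L - 1) → Edge 3 L → EuclideanSpace ℝ (Fin 3) => ∏ j, ∏ e, g (f j e) :=
    Finset.measurable_prod _ fun j _ => (hpm (Edge 3 L)).comp (measurable_pi_apply j)
  unfold restParamMeasure restLebesgue
  haveI : ∀ _j : Fin (2 * L - 1), SigmaFinite (Measure.pi fun _ : Edge 3 L => expMeasure) := fun _ => inferInstance
  haveI : ∀ _j : Fin (2 * L - 1), SigmaFinite (Measure.pi fun _ : Edge 3 L => (volume : Measure (EuclideanSpace ℝ (Fin 3)))) :=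
    fun _ => inferInstance
  haveI hB : SigmaFinite (Measure.pi fun _ : Fin (2 * L - 1) => Measure.pi fun _ : Edge 3 L =>
      (volume : Measure (EuclideanSpace ℝ (Fin 3)))) := inferInstance
  rw [hpi, h2, hpi, prod_withDensity' _ _ h2m (hpm _), prod_withDensity' _ _ (hpm _)
    (show Measurable (fun z : (Fin (2 * L - 1) → Edge 3 L → EuclideanSpace ℝ (Fin 3)) × ({y : Site 3 L // ¬ y = y₀} → EuclideanSpace ℝ (Fin 3)) =>
      (∏ j, ∏ e, g (z.1 j e)) * ∏ i, g (z.2 i)) from (h2m.comp measurable_fst).mul ((hpm _).comp measurable_snd))]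

/-! ## §2 Continuity of the window map -/

omit [NeZero L] in
/-- The inverse splitting is continuous. [folklore] -/
theorem continuous_fixSplit_symm : Continuous ⇑(fixSplit L e₀ y₀).symm := by
  refine Continuous.prodMk ?_ (Continuous.prodMk ?_ ?_)
  · refine continuous_pi fun i => ?_
    show Continuous fun p : (SU2 × SU2) × FixRest L e₀ y₀ => (if h : i = e₀ then p.1.2 else p.2.1 ⟨i, h⟩)
    by_cases h : i = e₀
    · simp only [h, dif_pos]; fun_prop
    · simp only [h, dif_neg, not_false_eq_true]; exact (continuous_apply _).comp (continuous_fst.comp continuous_snd)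
  · exact continuous_fst.comp (continuous_snd.comp continuous_snd)
  · refine continuous_pi fun y => ?_
    show Continuous fun p : (SU2 × SU2) × FixRest L e₀ y₀ => (if h : y = y₀ then p.1.1 else p.2.2.2 ⟨y, h⟩)
    by_cases h : y = y₀
    · simp only [h, dif_pos]; fun_prop
    · simp only [h, dif_neg, not_false_eq_true]
      exact (continuous_apply _).comp (continuous_snd.comp (continuous_snd.comp continuous_snd))

omit [NeZero L] in
/-- The conjugated rest charts are jointly continuous in `(z, b)`. [folklore] -/
theorem continuous_restChart_param (R : FixRest L e₀ y₀) :
    Continuous (Function.uncurry fun (z : EuclideanSpace ℝ (Fin 3)) (b : RestParam L e₀ y₀) => restChart R (expPoint z) b) := by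
  have hk : Continuous fun q : EuclideanSpace ℝ (Fin 3) × RestParam L e₀ y₀ => expPoint q.1 := continuous_expPoint.comp continuous_fst
  refine Continuous.prodMk ?_ (Continuous.prodMk ?_ ?_)
  · refine continuous_pi fun i => ?_
    exact (hk.mul ((continuous_expPoint.comp ((continuous_apply i).comp (continuous_fst.comp continuous_snd))).mul
      continuous_const)).mul hk.inv
  · refine continuous_pi fun j => continuous_pi fun e => ?_
    exact (hk.mul ((continuous_expPoint.comp ((continuous_apply e).comp ((continuous_apply j).comp
      (continuous_fst.comp (continuous_snd.comp continuous_snd))))).mul continuous_const)).mul hk.inv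
  · refine continuous_pi fun y => ?_
    exact (hk.mul ((continuous_expPoint.comp ((continuous_apply y).comp
      (continuous_snd.comp (continuous_snd.comp continuous_snd)))).mul continuous_const)).mul hk.inv

omit [NeZero L] in
/-- ★ The window map `Θ'` is continuous. [folklore] -/
theorem continuous_fixWindowMap (ωC ωN ωX : EuclideanSpace ℝ (Fin 3)) (C₀ N₀ : SU2) (R : FixRest L e₀ y₀) :
    Continuous (fixWindowMap ωC ωN ωX C₀ N₀ R) := by
  have hcomp : fixWindowMap ωC ωN ωX C₀ N₀ R =
      (fixSplit L e₀ y₀).symm ∘ (fun w : EuclideanSpace ℝ (Fin 3) × (EuclideanSpace ℝ (Fin 3) × RestParam L e₀ y₀) =>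
        (anchorMap ωC ωN ωX C₀ N₀ (w.1, w.2.1),
          (Function.uncurry fun (z : EuclideanSpace ℝ (Fin 3)) (b : RestParam L e₀ y₀) => restChart R (expPoint z) b) (w.1, w.2.2))) :=
    funext fun w => fixWindowMap_eq ωC ωN ωX C₀ N₀ R w
  rw [hcomp]
  refine continuous_fixSplit_symm.comp ?_
  exact (continuous_anchorMap.comp (continuous_fst.prodMk (continuous_fst.comp continuous_snd))).prodMk
    ((continuous_restChart_param R).comp (continuous_fst.prodMk (continuous_snd.comp continuous_snd)))

omit [NeZero L] in
/-- The window map `Θ'` is measurable. [folklore] -/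
theorem measurable_fixWindowMap (ωC ωN ωX : EuclideanSpace ℝ (Fin 3)) (C₀ N₀ : SU2) (R : FixRest L e₀ y₀) :
    Measurable (fixWindowMap ωC ωN ωX C₀ N₀ R) := by
  have hcomp : fixWindowMap ωC ωN ωX C₀ N₀ R =
      (fixSplit L e₀ y₀).symm ∘ (fun w : EuclideanSpace ℝ (Fin 3) × (EuclideanSpace ℝ (Fin 3) × RestParam L e₀ y₀) =>
        (anchorMap ωC ωN ωX C₀ N₀ (w.1, w.2.1),
          (Function.uncurry fun (z : EuclideanSpace ℝ (Fin 3)) (b : RestParam L e₀ y₀) => restChart R (expPoint z) b) (w.1, w.2.2))) :=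
    funext fun w => fixWindowMap_eq ωC ωN ωX C₀ N₀ R w
  rw [hcomp]
  refine (fixSplit L e₀ y₀).symm.measurable.comp ?_
  exact (Measurable.comp (g := anchorMap ωC ωN ωX C₀ N₀) continuous_anchorMap.measurable
    (measurable_fst.prodMk (measurable_fst.comp measurable_snd))).prodMk
    (Measurable.comp (g := Function.uncurry fun (z : EuclideanSpace ℝ (Fin 3)) (b : RestParam L e₀ y₀) => restChart R (expPoint z) b)
      (measurable_restChart_param R) (measurable_fst.prodMk (measurable_snd.comp measurable_snd)))

/-! ## §3 The linear chart: `Leb³ ⊗ (Leb³ ⊗ restParamMeasure)` through `id × fixCoord` -/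

/-- ★★ **The rest law through the Euclidean model**: on `Φ × closedBall_V R` (`R < π`),
`(Leb³ ⊗ (Leb³ ⊗ restParamMeasure))|_{(id × fixCoord)(Φ × B̄_R)} = (id × fixCoord)_*((restWeight ∘ rest ∘ fixCoord) · (Leb³ ⊗ vol_V)|_{Φ × B̄_R})`.
[cite: Breitung1994, §2.3 Definitions 4–5] [cite: Helgason2000, Ch. I §1 Thm 1.14] -/
theorem restrict_image_fixCoord_window {Φ : Set (EuclideanSpace ℝ (Fin 3))} (hΦ : MeasurableSet Φ) {R : ℝ} (hR : R < Real.pi) :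
    ((volume : Measure (EuclideanSpace ℝ (Fin 3))).prod
        ((volume : Measure (EuclideanSpace ℝ (Fin 3))).prod (restParamMeasure L e₀ y₀))).restrict
        (Prod.map id (fixCoord (L := L) (e₀ := e₀) (y₀ := y₀)) '' (Φ ×ˢ closedBall (0 : EuclideanSpace ℝ (Fin (fixDim L e₀ y₀))) R)) =
      ((((volume : Measure (EuclideanSpace ℝ (Fin 3))).prod (volume : Measure (EuclideanSpace ℝ (Fin (fixDim L e₀ y₀))))).restrict
          (Φ ×ˢ closedBall (0 : EuclideanSpace ℝ (Fin (fixDim L e₀ y₀))) R)).withDensity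
        fun w => ENNReal.ofReal (restWeight (fixCoord w.2).2)).map (Prod.map id fixCoord) := by
  set g : EuclideanSpace ℝ (Fin 3) → ℝ≥0∞ :=
    (ball (0 : EuclideanSpace ℝ (Fin 3)) Real.pi).indicator fun x => ENNReal.ofReal (expWeight x) with hg
  have hgm : Measurable g := measurable_expWeight.ennreal_ofReal.indicator measurableSet_ball
  set G : RestParam L e₀ y₀ → ℝ≥0∞ := fun b => (∏ i, g (b.1 i)) * ((∏ j, ∏ e, g (b.2.1 j e)) * ∏ s, g (b.2.2 s)) with hG
  have hGm : Measurable G := by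
    have h1 : ∀ (ι : Type) [Fintype ι], Measurable fun b : ι → EuclideanSpace ℝ (Fin 3) => ∏ i, g (b i) := fun ι _ =>
      Finset.measurable_prod _ fun i _ => hgm.comp (measurable_pi_apply i)
    refine ((h1 _).comp measurable_fst).mul (Measurable.mul ?_ ((h1 _).comp (measurable_snd.comp measurable_snd)))
    exact (Finset.measurable_prod _ fun j _ => (h1 (Edge 3 L)).comp (measurable_pi_apply j)).comp (measurable_fst.comp measurable_snd)
  have hρ : restParamMeasure L e₀ y₀ = (restLebesgue L e₀ y₀).withDensity G := restParamMeasure_eq_withDensity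
  set P : EuclideanSpace ℝ (Fin 3) × EuclideanSpace ℝ (Fin (fixDim L e₀ y₀)) →
      EuclideanSpace ℝ (Fin 3) × (EuclideanSpace ℝ (Fin 3) × RestParam L e₀ y₀) := Prod.map id fixCoord with hP
  have hPmp : MeasurePreserving P ((volume : Measure (EuclideanSpace ℝ (Fin 3))).prod volume)
      ((volume : Measure (EuclideanSpace ℝ (Fin 3))).prod ((volume : Measure (EuclideanSpace ℝ (Fin 3))).prod (restLebesgue L e₀ y₀))) :=
    (MeasurePreserving.id volume).prod measurePreserving_fixCoord
  have hPemb : MeasurableEmbedding P := MeasurableEmbedding.id.prodMap measurableEmbedding_fixCoord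
  set W := Φ ×ˢ closedBall (0 : EuclideanSpace ℝ (Fin (fixDim L e₀ y₀))) R with hW
  have hWm : MeasurableSet W := hΦ.prod measurableSet_closedBall
  haveI : ∀ _j : Fin (2 * L - 1), SigmaFinite (Measure.pi fun _ : Edge 3 L => (volume : Measure (EuclideanSpace ℝ (Fin 3)))) :=
    fun _ => inferInstance
  haveI hB : SigmaFinite (Measure.pi fun _ : Fin (2 * L - 1) => Measure.pi fun _ : Edge 3 L =>
      (volume : Measure (EuclideanSpace ℝ (Fin 3)))) := inferInstance
  haveI : SigmaFinite (restLebesgue L e₀ y₀) := by unfold restLebesgue; infer_instance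
  -- the ambient measure through `P`
  have hamb : (volume : Measure (EuclideanSpace ℝ (Fin 3))).prod
      ((volume : Measure (EuclideanSpace ℝ (Fin 3))).prod (restParamMeasure L e₀ y₀)) =
      (((volume : Measure (EuclideanSpace ℝ (Fin 3))).prod (volume : Measure (EuclideanSpace ℝ (Fin (fixDim L e₀ y₀))))).withDensity
        fun w => G (fixCoord w.2).2).map P := by
    rw [hρ, prod_withDensity_right hGm,
      prod_withDensity_right (show Measurable fun z : EuclideanSpace ℝ (Fin 3) × RestParam L e₀ y₀ => G z.2 from hGm.comp measurable_snd),
      ← hPmp.map_eq,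
      Literature.Analysis.Asymptotics.withDensity_map_eq_map_withDensity_comp hPmp.measurable
        (show Measurable fun z : EuclideanSpace ℝ (Fin 3) × (EuclideanSpace ℝ (Fin 3) × RestParam L e₀ y₀) => G z.2.2 from
          (hGm.comp measurable_snd).comp measurable_snd)]
    rfl
  rw [hamb, hPemb.restrict_map, preimage_image_eq _ hPemb.injective, restrict_withDensity hWm]
  congr 1
  refine withDensity_congr_ae ((ae_restrict_iff' hWm).2 (Filter.Eventually.of_forall fun w hw => ?_))
  -- on the window every rest component lies in the ball of radius `π`, where the indicator is `1`
  have hy : ‖w.2‖ ≤ R := mem_closedBall_zero_iff.1 hw.2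
  have hin : ∀ x : EuclideanSpace ℝ (Fin 3), ‖x‖ ≤ ‖w.2‖ → g x = ENNReal.ofReal (expWeight x) := fun x hx => by
    rw [hg, indicator_of_mem (mem_ball_zero_iff.2 (lt_of_le_of_lt (hx.trans hy) hR))]
  show G (fixCoord w.2).2 = ENNReal.ofReal (restWeight (fixCoord w.2).2)
  rw [hG, restWeight]
  simp only []
  rw [ENNReal.ofReal_mul (Finset.prod_nonneg fun i _ => expWeight_nonneg _),
    ENNReal.ofReal_mul (Finset.prod_nonneg fun j _ => Finset.prod_nonneg fun e _ => expWeight_nonneg _),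
    ENNReal.ofReal_prod_of_nonneg fun i _ => expWeight_nonneg _,
    ENNReal.ofReal_prod_of_nonneg fun j _ => Finset.prod_nonneg fun e _ => expWeight_nonneg _,
    ENNReal.ofReal_prod_of_nonneg fun s _ => expWeight_nonneg _]
  congr 1
  · exact Finset.prod_congr rfl fun i _ => hin _ (norm_fixCoord_snd_fst_le w.2 i)
  congr 1
  · refine Finset.prod_congr rfl fun j _ => ?_
    rw [ENNReal.ofReal_prod_of_nonneg fun e _ => expWeight_nonneg _]
    exact Finset.prod_congr rfl fun e _ => hin _ (norm_fixCoord_snd_snd_fst_le w.2 j e)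
  · exact Finset.prod_congr rfl fun s _ => hin _ (norm_fixCoord_snd_snd_snd_le w.2 s)

/-! ## §4 ★★★ The chart identity on `X_fix` in the format of the orbit theorem -/

/-- `restWeight` is measurable. [folklore] -/
theorem measurable_restWeight : Measurable (restWeight (L := L) (e₀ := e₀) (y₀ := y₀)) := by
  unfold restWeight
  refine (Finset.measurable_prod _ fun i _ => measurable_expWeight.comp ((measurable_pi_apply i).comp measurable_fst)).mul
    (Measurable.mul ?_ (Finset.measurable_prod _ fun s _ =>
      measurable_expWeight.comp ((measurable_pi_apply s).comp (measurable_snd.comp measurable_snd))))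
  exact Finset.measurable_prod _ fun j _ => Finset.measurable_prod _ fun e _ =>
    measurable_expWeight.comp ((measurable_pi_apply e).comp ((measurable_pi_apply j).comp (measurable_fst.comp measurable_snd)))

/-- `restWeight ≥ 0`. [folklore] -/
theorem restWeight_nonneg (b : RestParam L e₀ y₀) : 0 ≤ restWeight b := by
  unfold restWeight
  exact mul_nonneg (Finset.prod_nonneg fun _ _ => expWeight_nonneg _) (mul_nonneg
    (Finset.prod_nonneg fun _ _ => Finset.prod_nonneg fun _ _ => expWeight_nonneg _) (Finset.prod_nonneg fun _ _ => expWeight_nonneg _))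

/-- ★★★ **THE CHART IDENTITY `hloc` ON `X_fix` IN THE LITERAL FORMAT OF ✓`laplaceMethod_quantitative_orbit_tube`**: with `V = ℝ^{fixDim}`,
`Θ'(z, y) = fixWindowMap(z, fixCoord y)`, `Z = ℝ³ ∋ z` (`κ = Leb³`), a measurable `Φ ⊆ closedBall 0 r` (`r < π/2`) and `R_V < 1`:
`μ_fix|_{Θ'(Φ × B̄_{R_V})} = Θ'_*( J · (Leb³ ⊗ vol_V)|_{Φ × B̄_{R_V}} )`, `J(z, y) = restWeight(rest(fixCoord y)) · anchorDensity(z, a(fixCoord y))`.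
[cite: Helgason2000, Ch. I §1 Thm 1.14] [cite: Breitung1994, §2.3 Definitions 4–5; Thm 41 p. 56] [cite: Bredon1972, Ch. II §§4–5] -/
theorem fix_hloc {ωC ωN ωX : EuclideanSpace ℝ (Fin 3)} {C₀ N₀ : SU2} (hC : ‖ωC‖ = 1) (hN : ‖ωN‖ = 1)
    (hCN : ⟪ωC, ωN⟫ = 0) (hX : imQuat ωX = imQuat ωC * imQuat ωN) (hC₀ : su2Quat C₀ = imQuat ωC)
    (hN₀ : su2Quat N₀ = imQuat ωN ∨ su2Quat N₀ = -imQuat ωN) (R : FixRest L e₀ y₀) {Φ : Set (EuclideanSpace ℝ (Fin 3))}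
    (hΦm : MeasurableSet Φ) {r : ℝ} (hr : r < Real.pi / 2) (hΦ : Φ ⊆ closedBall (0 : EuclideanSpace ℝ (Fin 3)) r) {Rv : ℝ} (hRv : Rv < 1) :
    ((Measure.pi fun _ : OffIdx L => haarProbability SU2).prod
        ((Measure.pi fun _ : Fin (2 * L - 1) => configMeasure SU2 L).prod (gaugeMeasure L))).restrict
        ((fun w : EuclideanSpace ℝ (Fin 3) × EuclideanSpace ℝ (Fin (fixDim L e₀ y₀)) => fixWindowMap ωC ωN ωX C₀ N₀ R (w.1, fixCoord w.2)) ''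
          (Φ ×ˢ closedBall (0 : EuclideanSpace ℝ (Fin (fixDim L e₀ y₀))) Rv)) =
      ((((volume : Measure (EuclideanSpace ℝ (Fin 3))).prod (volume : Measure (EuclideanSpace ℝ (Fin (fixDim L e₀ y₀))))).restrict
          (Φ ×ˢ closedBall (0 : EuclideanSpace ℝ (Fin (fixDim L e₀ y₀))) Rv)).withDensity fun w =>
          ENNReal.ofReal (restWeight (fixCoord w.2).2 * anchorDensity ωC ωN ωX C₀ N₀ (w.1, (fixCoord w.2).1))).map
        (fun w : EuclideanSpace ℝ (Fin 3) × EuclideanSpace ℝ (Fin (fixDim L e₀ y₀)) => fixWindowMap ωC ωN ωX C₀ N₀ R (w.1, fixCoord w.2)) := by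
  haveI : OpensMeasurableSpace ((Fin (2 * L - 1) → GaugeConfig 3 L SU2) × (Site 3 L → SU2)) := Prod.opensMeasurableSpace
  haveI : OpensMeasurableSpace (FixSpace L) := Prod.opensMeasurableSpace
  have hRvπ : Rv < Real.pi := by linarith [Real.pi_gt_three]
  set Ψ : EuclideanSpace ℝ (Fin 3) × EuclideanSpace ℝ (Fin (fixDim L e₀ y₀)) →
      EuclideanSpace ℝ (Fin 3) × (EuclideanSpace ℝ (Fin 3) × RestParam L e₀ y₀) := Prod.map id fixCoord with hΨ
  set W := Φ ×ˢ closedBall (0 : EuclideanSpace ℝ (Fin (fixDim L e₀ y₀))) Rv with hW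
  have hWm : MeasurableSet W := hΦm.prod measurableSet_closedBall
  have hΨm : Measurable Ψ := measurable_id.prodMap measurable_fixCoord
  have hΨc : Continuous Ψ := continuous_id.prodMap continuous_fixCoord
  have hΨinj : Function.Injective Ψ := Function.injective_id.prodMap fixCoord_injective
  have hJ₁ : Measurable fun w : EuclideanSpace ℝ (Fin 3) × (EuclideanSpace ℝ (Fin 3) × RestParam L e₀ y₀) =>
      anchorDensity ωC ωN ωX C₀ N₀ (w.1, w.2.1) :=
    measurable_anchorDensity.comp (measurable_fst.prodMk (measurable_fst.comp measurable_snd))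
  have hJ₂ : Measurable fun w : EuclideanSpace ℝ (Fin 3) × EuclideanSpace ℝ (Fin (fixDim L e₀ y₀)) => restWeight (fixCoord w.2).2 :=
    measurable_restWeight.comp (measurable_snd.comp (measurable_fixCoord.comp measurable_snd))
  have hΨW : Ψ '' W ⊆ closedBall (0 : EuclideanSpace ℝ (Fin 3)) r ×ˢ (closedBall (0 : EuclideanSpace ℝ (Fin 3)) Rv ×ˢ
      ((Set.pi univ fun _ : {i : OffIdx L // ¬ i = e₀} =>
        (ball (0 : EuclideanSpace ℝ (Fin 3)) Real.pi ∪ {(Real.pi : ℝ) • EuclideanSpace.single (0 : Fin 3) (1 : ℝ)})) ×ˢ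
      ((Set.pi univ fun _ : Fin (2 * L - 1) => Set.pi univ fun _ : Edge 3 L =>
        (ball (0 : EuclideanSpace ℝ (Fin 3)) Real.pi ∪ {(Real.pi : ℝ) • EuclideanSpace.single (0 : Fin 3) (1 : ℝ)})) ×ˢ
      (Set.pi univ fun _ : {y : Site 3 L // ¬ y = y₀} =>
        (ball (0 : EuclideanSpace ℝ (Fin 3)) Real.pi ∪ {(Real.pi : ℝ) • EuclideanSpace.single (0 : Fin 3) (1 : ℝ)}))))) := by
    rintro _ ⟨⟨z, y⟩, ⟨hz, hy⟩, rfl⟩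
    have hyR : ‖y‖ ≤ Rv := mem_closedBall_zero_iff.1 hy
    have hb : ∀ x : EuclideanSpace ℝ (Fin 3), ‖x‖ ≤ ‖y‖ →
        x ∈ ball (0 : EuclideanSpace ℝ (Fin 3)) Real.pi ∪ {(Real.pi : ℝ) • EuclideanSpace.single (0 : Fin 3) (1 : ℝ)} := fun x hx =>
      ball_subset_expDomain (mem_ball_zero_iff.2 (lt_of_le_of_lt (hx.trans hyR) hRvπ))
    refine ⟨hΦ hz, ⟨mem_closedBall_zero_iff.2 ((norm_fixCoord_fst_le y).trans hyR), ?_⟩⟩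
    exact ⟨fun i _ => hb _ (norm_fixCoord_snd_fst_le y i), fun j _ e _ => hb _ (norm_fixCoord_snd_snd_fst_le y j e),
      fun s _ => hb _ (norm_fixCoord_snd_snd_snd_le y s)⟩
  have hinj := injOn_fixWindowMap hC hN hCN hX hC₀ hN₀ R hr hRv
  have hinjW : InjOn (fixWindowMap ωC ωN ωX C₀ N₀ R ∘ Ψ) W :=
    hinj.comp hΨinj.injOn fun w hw => hΨW (mem_image_of_mem Ψ hw)
  have hΘΨW : MeasurableSet (fixWindowMap ωC ωN ωX C₀ N₀ R '' (Ψ '' W)) := by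
    rw [← image_comp]
    exact hWm.image_of_continuousOn_injOn ((continuous_fixWindowMap ωC ωN ωX C₀ N₀ R).comp hΨc).continuousOn hinjW
  have h := Literature.Analysis.Asymptotics.chart_comp_of_injOn_ofReal
    (μ := (Measure.pi fun _ : OffIdx L => haarProbability SU2).prod
      ((Measure.pi fun _ : Fin (2 * L - 1) => configMeasure SU2 L).prod (gaugeMeasure L)))
    (κ := (volume : Measure (EuclideanSpace ℝ (Fin 3))).prod
      ((volume : Measure (EuclideanSpace ℝ (Fin 3))).prod (restParamMeasure L e₀ y₀)))
    (ν := (volume : Measure (EuclideanSpace ℝ (Fin 3))).prod (volume : Measure (EuclideanSpace ℝ (Fin (fixDim L e₀ y₀)))))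
    (measurable_fixWindowMap ωC ωN ωX C₀ N₀ R) hΨm hinj hJ₁ hJ₂ (fun w => restWeight_nonneg _) hΨW hΘΨW
    (fix_restrict_image_windowMap_domain hC hN hCN hX hC₀ hN₀ R hr hRv) (restrict_image_fixCoord_window hΦm hRvπ)
  exact h

end Summit.QuantumFields.YangMills.Theorems.VirialFluxGap.FixSplit

end
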